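import Summits.Ventures.HodgeKum4.Theorems.KummerFixedLocusDefs
import Summits.Ventures.HodgeKum4.Theorems.KummerFixedLocusFixedFourfoldPD
import Literature.AlgebraicGeometry.HodgeTheory.TransversalPointIntersectionNumber
import Literature.AlgebraicGeometry.HodgeTheory.ComplexOrientationDegreeOne
import Literature.AlgebraicTopology.SingularHomology.IntegralClassRingChange
import HarnessLib

/-!
# I1R from its geometric atom: a single transversal point gives `⟨w ∪ ρ(g)w, [X]⟩ = σ(4,4) = ±1`
(cell `hodge-kum4`, seat p2)

HONEST FRAMING.  PROVED: the implication
`HodgeTheory.Fulton1998_cupPairing_transversalPoint` (PRINT: Fulton, *Young Tableaux* App. B (9) /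
*Intersection Theory* Prop. 8.2, Cor. 19.2 — two smooth subvarieties of complementary dimension whose
scheme-theoretic intersection is one reduced point have intersection number `σ(a, b) = ±1` in the tree's
orientation normalisation) → `Kum4FixedFourfoldMeetsTranslates` (I1geo, `@[conjecture]`: `W ×_X gW`
is one reduced point for `g ∈ Γ(X) ∖ 1`) → I1R (the intersection numbers `⟨w ∪ ρ(g)w, [X]⟩ = ±1`,
stated as the conclusion of the theorem — not a definition).

Kernel content (`translate_pd`): for `g ∈ Γ(X)` with underlying automorphism `φ`, the class
`ρ(g) w = (φ⁻¹)^* w` is Poincaré dual to the translate `i ≫ φ : W ⟶ X` —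
`(φ⁻¹)^* w ⌢ [X] = (φ⁻¹)^* w ⌢ φ_*[X] = φ_*(φ^*(φ⁻¹)^* w ⌢ [X]) = φ_*(w ⌢ [X]) = φ_* i_*[W]`, using
`φ_*[X(ℂ)] = [X(ℂ)]` for the complex orientations (an automorphism is birational, hence of degree
`+1`: `hasDegree_one_complexOrientationInt_of_isBirational`) and the projection formula
`capProduct_map`.  Then Fulton's fact gives `⟨w ∪ ρ(g)w, [X]⟩ = σ(4,4)` over `ℤ`, and change of rings
`ℤ → ℂ` (`kroneckerPairing_cup_ringChange_complex`, `singularCohomology.ringChange_map`) gives the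
complex clause of I1R with `ε' = σ(4,4)`, the same sign for all `g ≠ 1`.
-/

noncomputable section

open CategoryTheory AlgebraicGeometry MonoidalCategory
open Literature.AlgebraicTopology.SingularHomology
open Literature.AlgebraicGeometry Literature.AlgebraicGeometry.HodgeTheory
open Literature.AlgebraicGeometry.Hyperkaehler (IsOfGeneralizedKummerType IsKummerFixedDatum)

namespace Summit.Ventures.HodgeKum4

variable {X W : Motives.SchemeOver ℂ}

/-- An automorphism of a smooth projective variety preserves the integral complex fundamental class:
`φ(ℂ)_*[X(ℂ)] = [X(ℂ)]` (birational ⟹ degree `+1`). -/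
theorem map_fundamentalClass_eq_of_aut (hX : Motives.IsSmoothProjective 8 X) (φ : Aut X) :
    singularHomology.map ℤ ℤ (Motives.AlgPoints.mapContinuous (L := ℂ) φ.hom) 16
        (complexOrientationInt hX).fundamentalClass = (complexOrientationInt hX).fundamentalClass := by
  have hbir : Resolution.IsBirational φ.hom.left := ⟨⊤, by simp, by simp, inferInstance⟩
  have h := hasDegree_one_complexOrientationInt_of_isBirational hX hX φ.hom hbir
  rw [HasDegree, one_smul] at h
  exact h

/-- **The translate class is Poincaré dual to the translate.**  If `w ⌢ [X] = i(ℂ)_*[W]` then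
`(φ⁻¹)^* w ⌢ [X] = (i ≫ φ)(ℂ)_*[W]` for every automorphism `φ` of `X`. -/
theorem translate_pd (hX : Motives.IsSmoothProjective 8 X) (hW : Motives.IsSmoothProjective 4 W)
    (i : W ⟶ X) (φ : Aut X) {w : singularCohomology ℤ ℤ (Motives.ComplexPoints X) 8}
    (hw : capProduct (M := ℤ) (rfl : 8 + 8 = 16) w (complexOrientationInt hX).fundamentalClass =
      singularHomology.map ℤ ℤ (Motives.AlgPoints.mapContinuous (L := ℂ) i) 8
        (complexOrientationInt hW).fundamentalClass) :
    capProduct (M := ℤ) (rfl : 8 + 8 = 16)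
        (singularCohomology.map ℤ ℤ (Motives.AlgPoints.mapContinuous (L := ℂ) φ.inv) 8 w)
        (complexOrientationInt hX).fundamentalClass =
      singularHomology.map ℤ ℤ (Motives.AlgPoints.mapContinuous (L := ℂ) (i ≫ φ.hom)) 8
        (complexOrientationInt hW).fundamentalClass := by
  set w' := singularCohomology.map ℤ ℤ (Motives.AlgPoints.mapContinuous (L := ℂ) φ.inv) 8 w with hw'
  -- `φ^* w' = w`
  have hid : singularCohomology.map ℤ ℤ (Motives.AlgPoints.mapContinuous (L := ℂ) φ.inv) 8 ≫
      singularCohomology.map ℤ ℤ (Motives.AlgPoints.mapContinuous (L := ℂ) φ.hom) 8 = 𝟙 _ := by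
    rw [← singularCohomology.map_comp, ← Motives.AlgPoints.mapContinuous_comp, φ.hom_inv_id,
      Motives.AlgPoints.mapContinuous_id, singularCohomology.map_id]
  have hpull : singularCohomology.map ℤ ℤ (Motives.AlgPoints.mapContinuous (L := ℂ) φ.hom) 8 w' = w := by
    rw [hw', ← ConcreteCategory.comp_apply, hid]
    rfl
  -- projection formula along `φ(ℂ)` with `φ(ℂ)_*[X] = [X]`
  have key := capProduct_map (R := ℤ) (M := ℤ) (Motives.AlgPoints.mapContinuous (L := ℂ) φ.hom)
    (rfl : 8 + 8 = 16) w' (complexOrientationInt hX).fundamentalClass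
  rw [hpull, map_fundamentalClass_eq_of_aut hX φ, hw] at key
  rw [Motives.AlgPoints.mapContinuous_comp, singularHomology.map_comp, ConcreteCategory.comp_apply]
  exact key.symm

/-- The translate `i ≫ φ` of a closed immersion by an automorphism is a closed immersion. -/
theorem isClosedImmersion_comp_aut (i : W ⟶ X) (hi : IsClosedImmersion i.left) (φ : Aut X) :
    IsClosedImmersion (i ≫ φ.hom).left := by
  haveI := hi
  rw [Over.comp_left]
  infer_instance

/-- `ρ(g) w_ℂ = ((g⁻¹)^* w)_ℂ`: the representation `middleRep` on the complexification of an integral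
class is the complexification of the integral pull-back along the inverse automorphism. -/
theorem middleRep_ringChange (g : autFixingH2H3 X) (w : singularCohomology ℤ ℤ (Motives.ComplexPoints X) 8) :
    middleRep X g (singularCohomology.ringChange (algebraMap ℤ ℂ) (Motives.ComplexPoints X) 8 w) =
      singularCohomology.ringChange (algebraMap ℤ ℂ) (Motives.ComplexPoints X) 8
        (singularCohomology.map ℤ ℤ (Motives.AlgPoints.mapContinuous (L := ℂ) g.val.inv) 8 w) := by
  rw [middleRep_apply, singularCohomology.ringChange_map]
  rfl

/-- **I1R — the fixed fourfold meets its `Γ`-translates in `±1` — from the geometric residual I1geo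
and Fulton's printed intersection-number fact.**  For `X` smooth projective of `Kum⁴`-type, a Kummer
fixed datum `(ι, W, i)` (`Hyperkaehler.IsKummerFixedDatum`), and the integral Poincaré dual `w` of `W`
for the complex orientations of the tree (`w ⌢ [X(ℂ)] = i(ℂ)_*[W(ℂ)]`): there is a sign `ε' = ±1`
(namely Fulton's `σ(4,4)`) with `⟨w_ℂ ∪ ρ(g) w_ℂ, [X(ℂ)]_ℂ⟩ = ε'` for every `g ∈ Γ(X) ∖ 1`
(`ρ(g) = (g⁻¹)^*`).  This numerical form (I1R) is what crux I consumes (`KummerFixedLocusI2Closing`);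
it is a THEOREM here, not a definition (one residual vocabulary: I1geo). -/
theorem kum4FixedFourfoldTranslatesR_of_meetsTranslates
    (hF : Fulton1998_cupPairing_transversalPoint) (hgeo : Kum4FixedFourfoldMeetsTranslates)
    ⦃X : Motives.SchemeOver ℂ⦄ (hX : Motives.IsSmoothProjective 8 X) (hK : IsOfGeneralizedKummerType 4 X)
    (ι : Aut X) ⦃W : Motives.SchemeOver ℂ⦄ (hW : Motives.IsSmoothProjective 4 W) (i : W ⟶ X)
    (hD : Hyperkaehler.IsKummerFixedDatum X ι W i)
    (w : singularCohomology ℤ ℤ (Motives.ComplexPoints X) 8)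
    (hw : capProduct (M := ℤ) (rfl : 8 + 8 = 16) w (complexOrientationInt hX).fundamentalClass =
      singularHomology.map ℤ ℤ (Motives.AlgPoints.mapContinuous (L := ℂ) i) 8
        (complexOrientationInt hW).fundamentalClass) :
    ∃ ε' : ℤ, (ε' = 1 ∨ ε' = -1) ∧ ∀ g : autFixingH2H3 X, g ≠ 1 →
      complexPairingWith X (complexOrientationInt hX)
          (singularCohomology.ringChange (algebraMap ℤ ℂ) (Motives.ComplexPoints X) 8 w)
          (middleRep X g
            (singularCohomology.ringChange (algebraMap ℤ ℂ) (Motives.ComplexPoints X) 8 w)) = ε' := by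
  obtain ⟨σ, hσ, hF⟩ := Fulton1998_cupPairing_transversalPoint.dim44 hF
  refine ⟨σ, hσ, fun g hg => ?_⟩
  obtain ⟨p, q, hpq⟩ := hgeo hX hK ι i hD g hg
  have hi : IsClosedImmersion i.left := hD.isClosedImmersion
  set w' := singularCohomology.map ℤ ℤ (Motives.AlgPoints.mapContinuous (L := ℂ) g.val.inv) 8 w
    with hw'
  have hw'pd := translate_pd hX hW i g.val hw
  have hpair : cupPairing (complexOrientationInt hX) (rfl : 8 + 8 = 16) w w' = σ :=
    hF hX hW hW i (i ≫ g.val.hom) hi (isClosedImmersion_comp_aut i hi g.val) ⟨p, q, hpq⟩ w w' hw hw'pd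
  rw [middleRep_ringChange, complexPairingWith_apply, complexFundamentalClass,
    kroneckerPairing_cup_ringChange_complex (rfl : 8 + 8 = 16) (complexOrientationInt hX) w w', hpair]

end Summit.Ventures.HodgeKum4

end
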